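import Mathlib
import Summits.QuantumAdvantage.QuantumAdvantage.Theses.AbsorptionDial
import Summits.QuantumAdvantage.QuantumAdvantage.Theses.DeterministicLeaf
import HarnessLib
import HarnessLib.Audit

/-!
# GradeDial, part A/2 — the Razborov–Smolensky bridge AT THE QUASI-POLYNOMIAL GRADE; proof of the open item
26764 `DeterministicLeaf.DetBridgeOdd` (part B: the walk→ring transport at the quasi grade and items 26768 — both
copies —, 26765, 26766)

Prop-free tree twin of the decomposition-cell node «GradeDial» (cell decomp-qadv, lens-5 g25,
`pub/decomp-qadv/decomp-qadv-lens-5/g25/GradeDial.lean`).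

THE MECHANISM.  The deterministic leaf `DetSepOdd` (stmt 26761: zero-error advice-free `QNC⁰ ⊄` deterministic
`FAC⁰[p]`, every prime `p ≥ 5`, witnessed by BGK's 2D HLF family) follows from an upper bound on the number of ring
patterns on which low-degree `𝔽_p` polynomial maps solve `RingHLF.Rel`, by restricting `N × N` HLF tuples to the
`8t`-cycle instances (`GridCycle`, tree) and the relational Razborov–Smolensky lemma `Smolensky.exists_uniformProb_le`
(degree `((p-1)ℓ)^{d+1}`, additive error `Σ(size+2)/p^ℓ`).  With the parameter
`ℓ = (log₂ N + 2)^A + (log₂ N + 1)(k_s + 3)` the degree is still polylogarithmic, `≤ (log₂ 8t)^{2(A+2)(d+1)}`, and the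
error is `< 2^{-(log₂ 8t)^A}`; so the bridge closes from the QUASI-POLYNOMIAL loss grade
«every polylog-degree map fails on at least a `2^{-(log₂ 8t)^A}` fraction, `A` uniform in the degree exponent»
(`hlfSubunit_of_ringQuasiLoss8`, `detSepOdd_of_ringQuasiLoss8Odd`).  The 1/poly grade `RingPolyLoss8Odd` (26762) and
the walk-grain 1/poly grade `WalkPolyLossOdd` (26767) imply the quasi grade (`ringQuasi_of_ringPolyLoss8Odd`,
`walkQuasi_of_walkPolyLossOdd`, schedule `A = 2`), and the landed constant-`θ` transports `walkTransportF`,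
`ringHardOfOdd` re-run verbatim with the constant bound replaced by a graded one (`oddClass_le_of_walk_bound`,
`ring_le_of_oddClass_bound`, `ringQuasi_of_walkQuasi`: walk exponent `A` ↦ ring exponent `A + 1`).

ITEM PROVED BY NAME HERE: `detBridgeOdd_holds : DeterministicLeaf.DetBridgeOdd` (26764, the route's load-bearing
support, «LAND FIRST»).  Part B (`Theorems.GradeDialB`): `polyLossBridgeOdd_holds(')` (26768, both copies),
`xformRingPolyLoss8_holds` (26765), `xformDetSep_holds` (26766).

Sources: A. Razborov, Math. Notes 41 (1987); R. Smolensky, STOC 1987 (doi:10.1145/28395.28404) — tree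
`Literature.Computability.MetaComplexity.SmolenskyRelations`; S. Bravyi, D. Gosset, R. König, Science 362 (2018)
(arXiv:1704.00690) — tree `qnc0Solves_hlfFamily`; A. Watts, R. Kothari, L. Schaeffer, A. Tal, STOC 2019
(arXiv:1906.08890) §1.3.  Proof skeleton of `hlfSubunit_of_ringQuasiLoss8` / `detHard_hlfFamily_of_subunit` after the
cell's lens-6 file `DeterministicLeaf.lean` (`hlfSubunit_of_ringPolyLoss8`, planner-decomp-qadv-lens-6), re-budgeted.
-/

-- D-0017: single-conjunct summit ⇒ the duplicate `QuantumAdvantage.QuantumAdvantage` is mandated.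
set_option linter.dupNamespace false

noncomputable section

open Classical
open Finset Polynomial
open Literature.Computability.Cryptography Literature.Computability.Complexity
open Literature.Computability.QuantumComplexity Literature.Computability.MetaComplexity
open Summit.QuantumAdvantage.AdviceFreeQNC0
open Summit.QuantumAdvantage.QuantumAdvantage.Theses

namespace Summit.QuantumAdvantage.QuantumAdvantage.Theorems.GradeDial

/-! ### §1 Arithmetic of the two grades -/

/-- `N^K ≤ 2^{(log₂ N + 1)·K}`. -/
theorem pow_le_two_pow_log_succ_mul (N K : ℕ) : N ^ K ≤ 2 ^ ((Nat.log 2 N + 1) * K) := by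
  rw [pow_mul]
  exact Nat.pow_le_pow_left (Nat.lt_pow_succ_log_self one_lt_two N).le K

/-- the quasi factor dominates the poly factor: `2^((log₂ n)²) ≥ n^k` once `n ≥ 2^(k+1)`. -/
theorem pow_le_two_pow_log_sq {n k : ℕ} (hn : 2 ^ (k + 1) ≤ n) : n ^ k ≤ 2 ^ ((Nat.log 2 n) ^ 2) := by
  have hL : k + 1 ≤ Nat.log 2 n := Nat.le_log_of_pow_le one_lt_two hn
  refine (pow_le_two_pow_log_succ_mul n k).trans (Nat.pow_le_pow_right (by norm_num) ?_)
  have : (Nat.log 2 n + 1) * k ≤ Nat.log 2 n * Nat.log 2 n := by nlinarith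
  simpa [sq] using this

/-- real form: `1/2^((log₂ n)²) ≤ 1/n^k` once `n ≥ 2^(k+1)`. -/
theorem one_div_quasi_le_one_div_poly {n k : ℕ} (hn : 2 ^ (k + 1) ≤ n) :
    1 / (2 : ℝ) ^ ((Nat.log 2 n) ^ 2) ≤ 1 / (n : ℝ) ^ k := by
  have hnpos : (0 : ℝ) < (n : ℝ) ^ k := by
    have : (0 : ℝ) < n := by exact_mod_cast lt_of_lt_of_le (Nat.two_pow_pos _) hn
    positivity
  refine one_div_le_one_div_of_le hnpos ?_
  exact_mod_cast pow_le_two_pow_log_sq hn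

/-- the poly grade implies the quasi grade, pointwise in the bound. -/
theorem poly_bound_le_quasi_bound {n k : ℕ} (hn : 2 ^ (k + 1) ≤ n) (M : ℝ) (hM : 0 ≤ M) :
    (1 - 1 / (n : ℝ) ^ k) * M ≤ (1 - 1 / (2 : ℝ) ^ ((Nat.log 2 n) ^ 2)) * M :=
  mul_le_mul_of_nonneg_right (by linarith [one_div_quasi_le_one_div_poly hn]) hM

/-! ### §2 The Razborov–Smolensky bridge at the quasi grade -/

/-- **instance form**: from the quasi ring grade with exponent `A` (uniform in the degree exponent `c`), every
`FAC⁰[p]` tuple for `N × N` 2D HLF (any number `r` of random bits) has success probability `< 1` on some valid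
instance, for all large `N`.  Razborov–Smolensky parameter `ℓ = (L+2)^A + (L+1)(k_s+3)`, `L = log₂ N`: error
`N²(s(N)+2)/p^ℓ < 2^{-(log₂ 8t)^A}`, degree `((p-1)ℓ)^{d+1} ≤ (log₂ 8t)^{2(A+2)(d+1)}`. -/
theorem hlfSubunit_of_ringQuasiLoss8 (p : ℕ) [Fact p.Prime] {A : ℕ}
    (hA : ∀ c : ℕ, ∃ t₀ : ℕ, ∀ t ≥ t₀,
      ∀ P : Fin (8 * t) → Smolensky.CubeFn (ZMod p) (8 * t),
        (∀ i, P i ∈ Smolensky.lowDeg (ZMod p) (8 * t) ((Nat.log 2 (8 * t)) ^ c)) →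
        ((univ.filter fun x : Fin (8 * t) → Bool =>
            RingHLF.Rel x (fun i => decide (P i x = 1))).card : ℝ) ≤
          (1 - 1 / (2 : ℝ) ^ ((Nat.log 2 (8 * t)) ^ A)) * (2 : ℝ) ^ (8 * t)) :
    ∀ d : ℕ, ∀ s : Polynomial ℕ, ∃ N₀ : ℕ, ∀ N ≥ N₀,
      ∀ (r : ℕ) (Cs : Fin N × Fin N → Circuit (Fin (inLen N + r))),
        (∀ v, (Cs v).IsOver (accBasis p)) → (∀ v, (Cs v).acDepth ≤ d) →
        (∀ v, (Cs v).size ≤ s.eval N) →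
        ∃ I : HLFInstance N, I.IsValid ∧
          uniformProb r
            {ρ | (fun v => (Cs v).eval (Fin.append (encodeHLF I) fun i => ρ.getD i false)) ∈
              hlfSolutions I} < 1 := by
  classical
  have hp := (Fact.out : p.Prime)
  intro d s
  -- size bound `s(N) ≤ cs N^ks + cs`
  obtain ⟨cs, ks, hcs⟩ := exists_eval_le_mul_pow_add s
  -- quasi ring loss at degree exponent `2 (A + 2) (d + 1)`
  obtain ⟨t₀, ht₀⟩ := hA (2 * (A + 2) * (d + 1))
  -- the thresholds
  set K : ℕ := ks + 4 with hK
  set M : ℕ := (p - 1) * K with hM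
  refine ⟨max (max 5 (2 * t₀ + 1)) (max (2 * cs + 3) (2 ^ M)),
    fun N hN r Cs hover hdep hsize => ?_⟩
  have hN5 : 5 ≤ N := le_trans (le_max_left _ _) (le_trans (le_max_left _ _) hN)
  have hNt₀ : 2 * t₀ + 1 ≤ N := le_trans (le_max_right _ _) (le_trans (le_max_left _ _) hN)
  have hNc : 2 * cs + 3 ≤ N := le_trans (le_max_left _ _) (le_trans (le_max_right _ _) hN)
  have hNM : 2 ^ M ≤ N := le_trans (le_max_right _ _) (le_trans (le_max_right _ _) hN)
  -- the cycle of length `8t` in the grid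
  set t : ℕ := (N - 1) / 2 with ht
  have ht2 : 2 ≤ t := by omega
  have htN : 2 * t < N := by omega
  have hn3 : 3 ≤ 8 * t := by omega
  have hNn : N ≤ 8 * t := by omega
  have h8t4N : 8 * t ≤ 4 * N := by omega
  have htt₀ : t₀ ≤ t := by omega
  let γ : GridCycle N (8 * t) := GridCycle.square t ht2 htN
  -- logarithms
  set L : ℕ := Nat.log 2 N with hL
  set L8 : ℕ := Nat.log 2 (8 * t) with hL8
  have hL2 : 2 ≤ L := by
    rw [hL]
    exact Nat.le_log_of_pow_le one_lt_two (by omega : 2 ^ 2 ≤ N)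
  have hLL8 : L ≤ L8 := by
    rw [hL, hL8]
    exact Nat.log_mono_right hNn
  have hL8L : L8 ≤ L + 2 := by
    have h1 : N < 2 ^ (L + 1) := by
      rw [hL]
      exact Nat.lt_pow_succ_log_self one_lt_two N
    have h2 : 8 * t < 2 ^ (L + 3) := by
      have : 2 ^ (L + 3) = 4 * 2 ^ (L + 1) := by ring
      omega
    have h3 : Nat.log 2 (8 * t) < L + 3 := Nat.log_lt_of_lt_pow (by omega) h2
    rw [hL8]
    omega
  have hML : M ≤ L := by
    rw [hL]
    exact Nat.le_log_of_pow_le one_lt_two hNM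
  -- the Razborov–Smolensky parameter
  set ℓ : ℕ := (L + 2) ^ A + (L + 1) * (ks + 3) with hℓ
  have hℓ1 : 1 ≤ ℓ := by
    have : 0 < (L + 1) * (ks + 3) := by positivity
    rw [hℓ]; omega
  -- the degree bound
  have hdeg : ((p - 1) * ℓ) ^ (d + 1) ≤ L8 ^ (2 * (A + 2) * (d + 1)) := by
    have h1 : ℓ ≤ K * (L + 2) ^ (A + 1) := by
      rw [hℓ, hK]
      have ha : (L + 2) ^ A ≤ (L + 2) ^ (A + 1) := Nat.pow_le_pow_right (by omega) (by omega)
      have hb : L + 1 ≤ (L + 2) ^ (A + 1) :=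
        calc L + 1 ≤ L + 2 := by omega
          _ = (L + 2) ^ 1 := (pow_one _).symm
          _ ≤ (L + 2) ^ (A + 1) := Nat.pow_le_pow_right (by omega) (by omega)
      nlinarith
    have h2 : (p - 1) * ℓ ≤ (L + 2) ^ (A + 2) :=
      calc (p - 1) * ℓ ≤ (p - 1) * (K * (L + 2) ^ (A + 1)) := Nat.mul_le_mul_left _ h1
        _ = M * (L + 2) ^ (A + 1) := by rw [hM]; ring
        _ ≤ (L + 2) * (L + 2) ^ (A + 1) := Nat.mul_le_mul_right _ (by omega)
        _ = (L + 2) ^ (A + 2) := by ring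
    have h3 : L + 2 ≤ L8 ^ 2 := by nlinarith
    calc ((p - 1) * ℓ) ^ (d + 1) ≤ ((L + 2) ^ (A + 2)) ^ (d + 1) := Nat.pow_le_pow_left h2 _
      _ ≤ ((L8 ^ 2) ^ (A + 2)) ^ (d + 1) := Nat.pow_le_pow_left (Nat.pow_le_pow_left h3 _) _
      _ = L8 ^ (2 * (A + 2) * (d + 1)) := by rw [← pow_mul, ← pow_mul, ← Nat.mul_assoc]
  -- the threshold `θ₀ = 1 − 2^{-(log₂ 8t)^A}`
  set θ₀ : ℝ := 1 - 1 / (2 : ℝ) ^ (L8 ^ A) with hθ₀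
  -- the polynomial-map bound from `RingQuasiLoss8` at ring length `8t`
  have hB : ∀ P : Fin (N * N) → Smolensky.CubeFn (ZMod p) (8 * t),
      (∀ j, P j ∈ Smolensky.lowDeg (ZMod p) (8 * t) (((p - 1) * ℓ) ^ (d + 1))) →
        ((univ.filter fun x : Fin (8 * t) → Bool =>
            (fun v => (fun j => decide (P j x = 1)) (finProdFinEquiv v)) ∈
              hlfSolutions (γ.ringInstance x)).card : ℝ) ≤ θ₀ * (2 : ℝ) ^ (8 * t) := by
    intro P hP
    let Q : Fin (8 * t) → Smolensky.CubeFn (ZMod p) (8 * t) :=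
      fun i => P (finProdFinEquiv (γ.toFun i))
    have hQ : ∀ i, Q i ∈ Smolensky.lowDeg (ZMod p) (8 * t) (L8 ^ (2 * (A + 2) * (d + 1))) :=
      fun i => Smolensky.lowDeg_mono hdeg (hP _)
    have hring := ht₀ t htt₀ Q hQ
    refine le_trans ?_ hring
    exact_mod_cast card_le_card fun x hx => by
      simp only [mem_filter, mem_univ, true_and] at hx ⊢
      exact GridCycle.rel_of_mem_hlfSolutions hn3 x hx
  -- the relational Razborov–Smolensky lemma
  obtain ⟨x, hx⟩ := Smolensky.exists_uniformProb_le hℓ1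
    (fun x : Fin (8 * t) → Bool => encodeHLF (γ.ringInstance x))
    (GridCycle.encodeHLF_ringInstance_subst γ)
    (fun j : Fin (N * N) => Cs (finProdFinEquiv.symm j))
    (fun j => hover _) (fun j => hdep _)
    (fun x z => (fun v => z (finProdFinEquiv v)) ∈ hlfSolutions (γ.ringInstance x)) hB
  refine ⟨γ.ringInstance x, GridCycle.ringInstance_isValid x, ?_⟩
  simp only [Equiv.symm_apply_apply] at hx
  refine lt_of_le_of_lt hx ?_
  have h2t : (2 : ℝ) ^ (8 * t) ≠ 0 := pow_ne_zero _ two_ne_zero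
  rw [mul_div_assoc, div_self h2t, mul_one]
  -- the error term
  have hpℓpos : (0 : ℝ) < (p : ℝ) ^ ℓ := by
    have : (0 : ℝ) < p := by exact_mod_cast hp.pos
    positivity
  have hsum : (∑ j : Fin (N * N), (((Cs (finProdFinEquiv.symm j)).size : ℝ) + 2)) ≤
      (N : ℝ) * N * (((s.eval N : ℕ) : ℝ) + 2) := by
    calc (∑ j : Fin (N * N), (((Cs (finProdFinEquiv.symm j)).size : ℝ) + 2))
        ≤ ∑ _j : Fin (N * N), (((s.eval N : ℕ) : ℝ) + 2) :=
          sum_le_sum fun j _ => by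
            have := hsize (finProdFinEquiv.symm j)
            exact add_le_add (by exact_mod_cast this) le_rfl
      _ = (N : ℝ) * N * (((s.eval N : ℕ) : ℝ) + 2) := by
          rw [sum_const, card_univ, Fintype.card_fin, nsmul_eq_mul]
          push_cast
          ring
  -- the key integer inequality `N²(s(N)+2)·2^{(log₂ 8t)^A} < 2^ℓ`
  have hkeyN : N * N * (s.eval N + 2) * 2 ^ (L8 ^ A) < 2 ^ ℓ := by
    have h1 : N * N * (s.eval N + 2) ≤ (2 * cs + 2) * N ^ (ks + 2) := by
      have hsN := hcs N
      have hNks : 1 ≤ N ^ ks := Nat.one_le_pow _ _ (by omega)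
      have h' : s.eval N + 2 ≤ (2 * cs + 2) * N ^ ks := by nlinarith
      calc N * N * (s.eval N + 2) ≤ N * N * ((2 * cs + 2) * N ^ ks) := Nat.mul_le_mul_left _ h'
        _ = (2 * cs + 2) * N ^ (ks + 2) := by ring
    have h2 : (2 * cs + 2) * N ^ (ks + 2) < N ^ (ks + 3) := by
      have hpos : 0 < N ^ (ks + 2) := by positivity
      calc (2 * cs + 2) * N ^ (ks + 2) < N * N ^ (ks + 2) :=
            mul_lt_mul_of_pos_right (by omega) hpos
        _ = N ^ (ks + 3) := by ring
    have h3 : N ^ (ks + 3) ≤ 2 ^ ((L + 1) * (ks + 3)) := by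
      rw [hL]
      exact pow_le_two_pow_log_succ_mul N (ks + 3)
    have h4 : 2 ^ (L8 ^ A) ≤ 2 ^ ((L + 2) ^ A) :=
      Nat.pow_le_pow_right (by norm_num) (Nat.pow_le_pow_left hL8L _)
    calc N * N * (s.eval N + 2) * 2 ^ (L8 ^ A)
        < N ^ (ks + 3) * 2 ^ (L8 ^ A) :=
          mul_lt_mul_of_pos_right (lt_of_le_of_lt h1 h2) (by positivity)
      _ ≤ 2 ^ ((L + 1) * (ks + 3)) * 2 ^ ((L + 2) ^ A) := Nat.mul_le_mul h3 h4
      _ = 2 ^ ℓ := by rw [hℓ, ← pow_add, add_comm]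
  have herr : (∑ j : Fin (N * N), (((Cs (finProdFinEquiv.symm j)).size : ℝ) + 2)) / (p : ℝ) ^ ℓ ≤
      (N : ℝ) * N * (((s.eval N : ℕ) : ℝ) + 2) / (2 : ℝ) ^ ℓ := by
    have h2ℓ : (0 : ℝ) < (2 : ℝ) ^ ℓ := by positivity
    have hp2 : (2 : ℝ) ^ ℓ ≤ (p : ℝ) ^ ℓ := by
      exact_mod_cast Nat.pow_le_pow_left hp.two_le ℓ
    calc (∑ j : Fin (N * N), (((Cs (finProdFinEquiv.symm j)).size : ℝ) + 2)) / (p : ℝ) ^ ℓ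
        ≤ (N : ℝ) * N * (((s.eval N : ℕ) : ℝ) + 2) / (p : ℝ) ^ ℓ :=
          div_le_div_of_nonneg_right hsum hpℓpos.le
      _ ≤ (N : ℝ) * N * (((s.eval N : ℕ) : ℝ) + 2) / (2 : ℝ) ^ ℓ :=
          div_le_div_of_nonneg_left (by positivity) h2ℓ hp2
  have hkey : (N : ℝ) * N * (((s.eval N : ℕ) : ℝ) + 2) / (2 : ℝ) ^ ℓ < 1 / (2 : ℝ) ^ (L8 ^ A) := by
    rw [div_lt_div_iff₀ (by positivity) (by positivity), one_mul]
    exact_mod_cast hkeyN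
  have hfin : θ₀ + (N : ℝ) * N * (((s.eval N : ℕ) : ℝ) + 2) / (2 : ℝ) ^ ℓ < 1 := by
    rw [hθ₀]; linarith
  exact lt_of_le_of_lt (add_le_add le_rfl herr) hfin

/-- **family form**: the instance statement transfers to deterministic hardness of `hlfFamily` (the `r = 0` case: a
deterministic tuple valid for one dummy `ρ` is valid for all, so its success event is `univ`, of probability `1`). -/
theorem detHard_hlfFamily_of_subunit {p : ℕ}
    (h : ∀ d : ℕ, ∀ s : Polynomial ℕ, ∃ N₀ : ℕ, ∀ N ≥ N₀,
      ∀ (r : ℕ) (Cs : Fin N × Fin N → Circuit (Fin (inLen N + r))),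
        (∀ v, (Cs v).IsOver (accBasis p)) → (∀ v, (Cs v).acDepth ≤ d) →
        (∀ v, (Cs v).size ≤ s.eval N) →
        ∃ I : HLFInstance N, I.IsValid ∧
          uniformProb r
            {ρ | (fun v => (Cs v).eval (Fin.append (encodeHLF I) fun i => ρ.getD i false)) ∈
              hlfSolutions I} < 1) :
    ∀ d : ℕ, ∀ s : Polynomial ℕ, ∃ N₀ : ℕ, ∀ n ≥ N₀,
      ∀ (Cs : Fin (hlfFamily.outLen n) → Circuit (Fin (hlfFamily.inLen n + 0))),
        (∀ i, (Cs i).IsOver (accBasis p)) → (∀ i, (Cs i).acDepth ≤ d) →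
        (∀ i, (Cs i).size ≤ s.eval n) →
        ∃ x ∈ hlfFamily.dom n, ∀ ρ : List Bool,
          ¬ hlfFamily.valid n x (fun i => (Cs i).eval (Fin.append x fun j => ρ.getD j false)) := by
  intro d s
  obtain ⟨N₀, hN₀⟩ := h d s
  refine ⟨N₀, fun N hN Cs hover hdep hsize => ?_⟩
  obtain ⟨I, hI, hprob⟩ := hN₀ N hN 0 (fun v => Cs (finProdFinEquiv v)) (fun v => hover _)
    (fun v => hdep _) (fun v => hsize _)
  refine ⟨encodeHLF I, ⟨I, hI, rfl⟩, fun ρ hvalid => ?_⟩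
  obtain ⟨I', hI', hII', hsol'⟩ := hvalid
  obtain rfl : I' = I := encodeHLF_injective_holds hI' hI hII'
  have key : ∀ S : Set (List Bool), uniformProb 0 S < 1 → (∀ ρ', ρ' ∈ S) → False := by
    intro S h1 h2
    rw [Set.eq_univ_iff_forall.mpr h2, uniformProb_univ] at h1
    exact lt_irrefl _ h1
  refine key _ hprob fun ρ' => ?_
  simp only [Set.mem_setOf_eq]
  have e' : (fun j : Fin 0 => ρ'.getD j false) = fun j : Fin 0 => ρ.getD j false :=
    funext fun j => j.elim0
  rw [e']
  exact hsol'

/-- **THE BRIDGE**: the quasi ring grade at every prime `p ≥ 5` gives `DetSepOdd` (item 26761's statement). -/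
theorem detSepOdd_of_ringQuasiLoss8Odd
    (h : ∀ (p : ℕ) [Fact p.Prime], 5 ≤ p → ∃ A : ℕ, ∀ c : ℕ, ∃ t₀ : ℕ, ∀ t ≥ t₀,
      ∀ P : Fin (8 * t) → Smolensky.CubeFn (ZMod p) (8 * t),
        (∀ i, P i ∈ Smolensky.lowDeg (ZMod p) (8 * t) ((Nat.log 2 (8 * t)) ^ c)) →
        ((univ.filter fun x : Fin (8 * t) → Bool =>
            RingHLF.Rel x (fun i => decide (P i x = 1))).card : ℝ) ≤
          (1 - 1 / (2 : ℝ) ^ ((Nat.log 2 (8 * t)) ^ A)) * (2 : ℝ) ^ (8 * t)) :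
    AbsorptionDial.DetSepOdd := by
  intro p _ hp
  obtain ⟨A, hA⟩ := h p hp
  exact ⟨hlfFamily, ⟨3 * X ^ 2, hlfFamily_inLen_le⟩, qnc0Solves_hlfFamily,
    detHard_hlfFamily_of_subunit (hlfSubunit_of_ringQuasiLoss8 p hA)⟩

/-- the 1/poly ring grade (26762) implies the quasi ring grade (schedule `A = 2`). -/
theorem ringQuasi_of_ringPolyLoss8Odd (h : DeterministicLeaf.RingPolyLoss8Odd) :
    ∀ (p : ℕ) [Fact p.Prime], 5 ≤ p → ∃ A : ℕ, ∀ c : ℕ, ∃ t₀ : ℕ, ∀ t ≥ t₀,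
      ∀ P : Fin (8 * t) → Smolensky.CubeFn (ZMod p) (8 * t),
        (∀ i, P i ∈ Smolensky.lowDeg (ZMod p) (8 * t) ((Nat.log 2 (8 * t)) ^ c)) →
        ((univ.filter fun x : Fin (8 * t) → Bool =>
            RingHLF.Rel x (fun i => decide (P i x = 1))).card : ℝ) ≤
          (1 - 1 / (2 : ℝ) ^ ((Nat.log 2 (8 * t)) ^ A)) * (2 : ℝ) ^ (8 * t) := by
  intro p _ hp
  refine ⟨2, fun c => ?_⟩
  obtain ⟨k, t₀, ht₀⟩ := h p hp c
  refine ⟨max t₀ (2 ^ (k + 1)), fun t ht P hP => ?_⟩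
  have ht₀' : t₀ ≤ t := le_of_max_le_left ht
  have htk : 2 ^ (k + 1) ≤ 8 * t := le_trans (le_of_max_le_right ht) (by omega)
  exact (ht₀ t ht₀' P hP).trans (poly_bound_le_quasi_bound htk _ (by positivity))

/-- **item 26764 `DeterministicLeaf.DetBridgeOdd` PROVED**: `RingPolyLoss8Odd → DetSepOdd`. -/
theorem detBridgeOdd_holds : DeterministicLeaf.DetBridgeOdd :=
  fun h => detSepOdd_of_ringQuasiLoss8Odd (ringQuasi_of_ringPolyLoss8Odd h)

end Summit.QuantumAdvantage.QuantumAdvantage.Theorems.GradeDial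

end
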